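import Summits.AtomisticToContinuum.Crystallization.Theorems.ShellsToBarlowChart.Negative.Calibration

/-!
# `ShellsToBarlowChart` (stmt-AtomisticToContinuum-9227), negative side II: load-bearing hypotheses

Part II of the crux disprover's negative-side lemmas (part I: `Calibration.lean`).  Any proof of
the crux must use:

* `S.Nonempty` — `shellsToBarlowChart_false_without_nonempty` (`S = ∅`);
* the upper scale bound — `shellsToBarlowChart_false_without_scaleUpper :
  ¬ ShellsToBarlowChartScaled (9/10) 2` (the ideal FCC stacking at scale `2`: perfect shells, no
  pair within the conclusion's bond window `(0, 28/25]`);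
* the lower scale bound — `shellsToBarlowChart_false_without_scaleLower :
  ¬ ShellsToBarlowChartScaled (1/2) 1` (scale `1/2`: thirteen in-layer window-neighbours against
  twelve contacts, counted through the bijection with `Set.ncard`);
* the exclusivity of the `5a/4`-shell — `shellsToBarlowChart_false_subshell` (with `↑T ⊆ shell`
  in place of `↑T = shell`, two interpenetrating FCC copies `B ∪ (B + (0,0,1/2))` refute it).

Reading: both ends of `[9/10, 1]` enter ONLY through the fixed bond window: the honest thresholds
are `1.01·hi ≤ 28/25` and `(√2 − 0.02)·lo > 28/25` (`lo > 0.8033`; `0.79196` for ideal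
stackings), so the planner's window has a margin of about `0.1` at both ends.  All `[folklore]`.
-/

noncomputable section

namespace Summit.AtomisticToContinuum.Crystallization.Theorems.ShellsToBarlowChartNegative

open Literature.Geometry.DiscreteGeometry Literature.MathematicalPhysics.StatisticalMechanics
open Summit.AtomisticToContinuum.Crystallization.Theses.PalmUnimodularRigidity

/-- Euclidean `3`-space. -/
local notation "E3" => EuclideanSpace ℝ (Fin 3)

/-! ## Load-bearing hypothesis 1: non-emptiness -/

/-- The empty set has (vacuously) good shells but is not in bijection with a Barlow stacking:
any proof must use `S.Nonempty`. [folklore] -/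
theorem shellsToBarlowChart_false_without_nonempty :
    ¬ ∀ S : Set E3, (∀ x ∈ S, GoodShellAt (9 / 10) 1 S x) → BarlowChart S := by
  intro h
  obtain ⟨s, -, Φ, hbij, -⟩ := h ∅ (fun x hx => hx.elim)
  exact hbij.mapsTo (barlowPos_mem (a := 1) (h := Real.sqrt (2 / 3)) (s := s) 0 0 0)

/-! ## Load-bearing hypothesis 2: the scale window `[9/10, 1]`

Both ends of the window are used by any proof, and ONLY through the bond window `(0, 28/25]` of
the conclusion: the conclusion hard-codes that the images of touching pairs are at distance
`≤ 28/25` and that nothing else is.  Ideal stackings at scale `2` (no pair closer than `2 > 28/25`)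
and at scale `1/2` (second and third neighbours, at `√2/2, √3/2, 1 ≤ 28/25`, enter the window)
have perfect shells at their own scale and violate the conclusion.  The two arguments below kill
every window containing a scale `c > 28/25` (no pair of the witness is close enough to be a bond)
or a scale `c` with `√3·c ≤ 28/25` (in-layer third neighbours become bonds; `c = 1/2` is used);
the honest thresholds for ideal stackings are `c > 28/25` and `√2·c ≤ 28/25` (`c ≤ 0.79196…`),
so the planner's `[9/10, 1]` has a margin of about `0.1` at both ends. -/

section ScaleWindow

/-- **The upper scale bound is load-bearing**: with window `[9/10, 2]` the crux is false — the
ideal FCC stacking at scale `2` has perfect shells, but any bond-isomorphism `Φ` would map two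
touching points of the unit stacking to distinct points at distance `≤ 28/25 < 2`. [folklore] -/
theorem shellsToBarlowChart_false_without_scaleUpper : ¬ ShellsToBarlowChartScaled (9 / 10) 2 := by
  intro h
  obtain ⟨s, hs, Φ, hbij, hiff⟩ := h (barlowStacking 2 (2 * Real.sqrt (2 / 3)) constHagg)
    ⟨_, barlowPos_mem 0 0 0⟩
    (fun x hx => goodShellAt_barlowStacking isHaggSeq_const (c := 2) two_pos (by norm_num) le_rfl hx)
  have hh : Real.sqrt (2 / 3) ^ 2 = 2 / 3 * (1 : ℝ) ^ 2 := by
    rw [Real.sq_sqrt (by norm_num)]; ring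
  have hpq : dist (barlowPos 1 (Real.sqrt (2 / 3)) s 0 0 0) (barlowPos 1 (Real.sqrt (2 / 3)) s 0 1 0)
      = 1 := by
    rw [dist_barlowPos_eq_iff hs one_pos hh]
    exact Or.inl ⟨rfl, by decide⟩
  obtain ⟨hpos, hle⟩ := (hiff _ (barlowPos_mem 0 0 0) _ (barlowPos_mem 0 1 0)).1 hpq
  have hne : Φ (barlowPos 1 (Real.sqrt (2 / 3)) s 0 0 0) ≠ Φ (barlowPos 1 (Real.sqrt (2 / 3)) s 0 1 0) := by
    intro e; rw [e, dist_self] at hpos; exact lt_irrefl _ hpos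
  have h2 : (2 : ℝ) ≤ dist (Φ (barlowPos 1 (Real.sqrt (2 / 3)) s 0 0 0))
      (Φ (barlowPos 1 (Real.sqrt (2 / 3)) s 0 1 0)) :=
    le_dist_of_mem_barlowStacking_ideal isHaggSeq_const two_pos (ideal_sq 2)
      (hbij.mapsTo (barlowPos_mem 0 0 0)) (hbij.mapsTo (barlowPos_mem 0 1 0)) hne
  linarith

/-- In-layer squared distances of a Barlow stacking: `a² (P² + PQ + Q²)`. [folklore] -/
theorem dist_barlowPos_inLayer_sq (a h : ℝ) (s : ℤ → ℤ) (k i j P Q : ℤ) :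
    dist (barlowPos a h s k i j) (barlowPos a h s k (i + P) (j + Q)) ^ 2 =
      a ^ 2 * ((P : ℝ) ^ 2 + P * Q + Q ^ 2) := by
  rw [dist_barlowPos_sq]
  have h3 : Real.sqrt 3 ^ 2 = 3 := Real.sq_sqrt (by norm_num)
  push_cast
  linear_combination (a ^ 2 * (Q : ℝ) ^ 2 / 4) * h3

/-- Thirteen in-layer index offsets with `1 ≤ P² + PQ + Q² ≤ 4`: the six touching ones, six at
form `4` (distance `2a`) and one at form `3` (distance `√3 a`). [folklore] -/
def thirteenOffsets : Finset (ℤ × ℤ) :=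
  {(1, 0), (-1, 0), (0, 1), (0, -1), (1, -1), (-1, 1),
   (2, 0), (-2, 0), (0, 2), (0, -2), (2, -2), (-2, 2), (1, 1)}

/-- There are thirteen of them. [folklore] -/
theorem card_thirteenOffsets : thirteenOffsets.card = 13 := by decide

/-- Each is non-zero with triangular form `≤ 4`. [folklore] -/
theorem thirteenOffsets_form :
    ∀ d ∈ thirteenOffsets, d ≠ (0, 0) ∧ d.1 ^ 2 + d.1 * d.2 + d.2 ^ 2 ≤ 4 := by decide

/-- **The lower scale bound is load-bearing**: with window `[1/2, 1]` the crux is false — the ideal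
FCC stacking at scale `1/2` has perfect shells, but each of its points has at least thirteen
other points within `28/25` (twelve at `1/2`, and more at `√3/2` and `1`), whereas a point of the
unit stacking touches only twelve; a bond-isomorphism `Φ` would inject the former into the image of
the latter. [folklore] -/
theorem shellsToBarlowChart_false_without_scaleLower : ¬ ShellsToBarlowChartScaled (1 / 2) 1 := by
  intro h
  obtain ⟨s, hs, Φ, hbij, hiff⟩ :=
    h (barlowStacking (1 / 2) (1 / 2 * Real.sqrt (2 / 3)) constHagg) ⟨_, barlowPos_mem 0 0 0⟩
      (fun x hx => goodShellAt_barlowStacking isHaggSeq_const (c := 1 / 2) (by norm_num) le_rfl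
        (by norm_num) hx)
  set B := barlowStacking 1 (Real.sqrt (2 / 3)) s with hB
  set S := barlowStacking (1 / 2) (1 / 2 * Real.sqrt (2 / 3)) constHagg with hSdef
  have hh1 : Real.sqrt (2 / 3) ^ 2 = 2 / 3 * (1 : ℝ) ^ 2 := by
    rw [Real.sq_sqrt (by norm_num)]; ring
  set p0 := barlowPos 1 (Real.sqrt (2 / 3)) s 0 0 0 with hp0def
  have hp0 : p0 ∈ B := barlowPos_mem 0 0 0
  obtain ⟨k, i, j, hy0⟩ : Φ p0 ∈ S := hbij.mapsTo hp0
  -- the twelve touching points of `p0`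
  set Q1 := {q : E3 | q ∈ B ∧ dist p0 q = 1} with hQ1def
  have hQ1 : Q1.ncard = 12 := ncard_touching_eq_twelve hs one_pos hh1 hp0
  have hQ1fin : Q1.Finite := Set.finite_of_ncard_ne_zero (by rw [hQ1]; norm_num)
  -- the window neighbours of `Φ p0`
  set N := {y : E3 | y ∈ S ∧ 0 < dist (Φ p0) y ∧ dist (Φ p0) y ≤ 28 / 25} with hNdef
  have hNsub : N ⊆ Φ '' Q1 := by
    rintro y ⟨hyS, hpos, hle⟩
    obtain ⟨q, hqB, rfl⟩ := hbij.surjOn hyS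
    exact ⟨q, ⟨hqB, (hiff p0 hp0 q hqB).2 ⟨hpos, hle⟩⟩, rfl⟩
  have hNfin : N.Finite := (hQ1fin.image Φ).subset hNsub
  have hN12 : N.ncard ≤ 12 :=
    calc N.ncard ≤ (Φ '' Q1).ncard := Set.ncard_le_ncard hNsub (hQ1fin.image Φ)
      _ ≤ Q1.ncard := Set.ncard_image_le hQ1fin
      _ = 12 := hQ1
  -- thirteen explicit window neighbours
  let f : ℤ × ℤ → E3 := fun d =>
    barlowPos (1 / 2) (1 / 2 * Real.sqrt (2 / 3)) constHagg k (i + d.1) (j + d.2)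
  have hdist : ∀ d : ℤ × ℤ, dist (Φ p0) (f d) ^ 2 = (1 / 2 : ℝ) ^ 2 * ((d.1 : ℝ) ^ 2 + d.1 * d.2 + d.2 ^ 2) := by
    intro d
    rw [hy0]
    exact dist_barlowPos_inLayer_sq _ _ _ _ _ _ _ _
  have hmaps : ∀ d ∈ (thirteenOffsets : Set (ℤ × ℤ)), f d ∈ N := by
    intro d hd
    obtain ⟨hd0, hd4⟩ := thirteenOffsets_form d hd
    have hform1 : (1 : ℤ) ≤ d.1 ^ 2 + d.1 * d.2 + d.2 ^ 2 :=
      one_le_sq_add_mul_add_sq (p := d.1) (q := d.2) (by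
        intro e; apply hd0; exact Prod.ext (by simpa using congrArg Prod.fst e)
          (by simpa using congrArg Prod.snd e))
    have hform1' : (1 : ℝ) ≤ (d.1 : ℝ) ^ 2 + d.1 * d.2 + d.2 ^ 2 := by exact_mod_cast hform1
    have hform4' : (d.1 : ℝ) ^ 2 + d.1 * d.2 + d.2 ^ 2 ≤ 4 := by exact_mod_cast hd4
    have hsq := hdist d
    have hnn : 0 ≤ dist (Φ p0) (f d) := dist_nonneg
    refine ⟨barlowPos_mem _ _ _, ?_, ?_⟩
    · nlinarith
    · nlinarith
  have hinj : Set.InjOn f (thirteenOffsets : Set (ℤ × ℤ)) := by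
    intro d _ d' _ heq
    by_contra hne
    have hidx : (i + d.1, j + d.2) ≠ (i + d'.1, j + d'.2) := by
      intro e
      apply hne
      simp only [Prod.mk.injEq] at e
      exact Prod.ext (by omega) (by omega)
    have hle := le_dist_barlowPos_of_ne (1 / 2) (1 / 2 * Real.sqrt (2 / 3)) constHagg
      (by norm_num) (k := k) hidx
    have : dist (f d) (f d') = 0 := by rw [heq, dist_self]
    simp only [f] at this
    linarith
  have h13 : 13 ≤ N.ncard := by
    have := Set.ncard_le_ncard_of_injOn f hmaps hinj hNfin
    rwa [Set.ncard_coe_finset, card_thirteenOffsets] at this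
  omega

end ScaleWindow


/-! ## Load-bearing hypothesis 3: the shell is ALL of the `5a/4`-ball ("nothing else that close")

Weakening `↑T = shell` to `↑T ⊆ shell` (twelve well-placed neighbours, possibly more points within
`5a/4`) is fatal: two interpenetrating copies `B ∪ (B + t)`, `t = (0, 0, 1/2)`, of the ideal FCC
stacking have twelve perfectly placed neighbours at every point, and a thirteenth point at
distance `1/2`. -/

section Exclusivity

/-- The half-layer shift `t = (0, 0, 1/2)`. [folklore] -/
def halfShift : E3 := !₂[0, 0, 1 / 2]

/-- Coordinates of `t`. [folklore] -/
@[simp] theorem halfShift_apply_zero : halfShift 0 = 0 := by simp [halfShift]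
/-- Coordinates of `t`. [folklore] -/
@[simp] theorem halfShift_apply_one : halfShift 1 = 0 := by simp [halfShift]
/-- Coordinates of `t`. [folklore] -/
@[simp] theorem halfShift_apply_two : halfShift 2 = 1 / 2 := by simp [halfShift]

/-- `‖t‖ = 1/2`. [folklore] -/
theorem norm_halfShift : ‖halfShift‖ = 1 / 2 := by
  rw [EuclideanSpace.norm_eq, Fin.sum_univ_three, halfShift_apply_zero, halfShift_apply_one,
    halfShift_apply_two]
  norm_num

/-- The shifted copy misses the original: layer heights `k·√(2/3)` never differ by `1/2`.
[folklore] -/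
theorem add_halfShift_not_mem {x : E3} (hx : x ∈ barlowStacking 1 (1 * Real.sqrt (2 / 3)) constHagg) :
    x + halfShift ∉ barlowStacking 1 (1 * Real.sqrt (2 / 3)) constHagg := by
  rintro ⟨k', i', j', hk'⟩
  obtain ⟨k, i, j, rfl⟩ := hx
  have h2 := congrArg (fun z : E3 => z 2) hk'
  simp only [PiLp.add_apply, barlowPos_apply_two, halfShift_apply_two] at h2
  have h2' : ((k' : ℝ) - k) * Real.sqrt (2 / 3) = 1 / 2 := by linarith
  have hsq : ((k' : ℝ) - k) ^ 2 * (2 / 3) = 1 / 4 := by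
    have := congrArg (· ^ 2) h2'
    simp only [mul_pow, Real.sq_sqrt (show (0:ℝ) ≤ 2 / 3 by norm_num)] at this
    linarith
  -- `8 (k' - k)² = 3` has no integer solution
  have hint : (8 : ℤ) * (k' - k) ^ 2 = 3 := by
    have h' : (8 : ℝ) * ((k' : ℝ) - k) ^ 2 = 3 := by linarith
    exact_mod_cast h'
  omega

/-- **"Nothing else that close" is load-bearing**: with `↑T ⊆ shell` the crux is false.
[folklore] -/
theorem shellsToBarlowChart_false_subshell :
    ¬ ∀ S : Set E3, S.Nonempty →
      (∀ x ∈ S, ∃ a : ℝ, 9 / 10 ≤ a ∧ a ≤ 1 ∧ ∃ T : Finset E3,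
        (↑T : Set E3) ⊆ (fun y : E3 => y - x) '' {y : E3 | y ∈ S ∧ y ≠ x ∧ dist y x ≤ 5 / 4 * a} ∧
        (ShellCloseTo (a / 100) T (Finset.image (fun v : E3 => a • v) fccKissingPattern) ∨
          ShellCloseTo (a / 100) T (Finset.image (fun v : E3 => a • v) hcpKissingPattern))) →
      BarlowChart S := by
  intro h
  set B1 := barlowStacking 1 (1 * Real.sqrt (2 / 3)) constHagg with hB1
  set S : Set E3 := B1 ∪ (fun y : E3 => y + halfShift) '' B1 with hS
  have hB1S : B1 ⊆ S := Set.subset_union_left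
  -- the weakened hypothesis holds on `S`
  have hgood : ∀ x ∈ S, ∃ a : ℝ, 9 / 10 ≤ a ∧ a ≤ 1 ∧ ∃ T : Finset E3,
      (↑T : Set E3) ⊆ (fun y : E3 => y - x) '' {y : E3 | y ∈ S ∧ y ≠ x ∧ dist y x ≤ 5 / 4 * a} ∧
      (ShellCloseTo (a / 100) T (Finset.image (fun v : E3 => a • v) fccKissingPattern) ∨
        ShellCloseTo (a / 100) T (Finset.image (fun v : E3 => a • v) hcpKissingPattern)) := by
    rintro x (hx | ⟨x0, hx0, rfl⟩)
    · obtain ⟨T, hT, hclose⟩ := goodShell_barlowStacking isHaggSeq_const one_pos hx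
      refine ⟨1, by norm_num, le_rfl, T, ?_, hclose⟩
      rw [hT]
      refine Set.image_mono ?_
      rintro y ⟨hy, hne, hle⟩
      exact ⟨hB1S hy, hne, by simpa using hle⟩
    · obtain ⟨T, hT, hclose⟩ := goodShell_barlowStacking isHaggSeq_const one_pos hx0
      refine ⟨1, by norm_num, le_rfl, T, ?_, hclose⟩
      rw [hT]
      rintro _ ⟨y, ⟨hy, hne, hle⟩, rfl⟩
      refine ⟨y + halfShift, ⟨Or.inr ⟨y, hy, rfl⟩, ?_, ?_⟩, add_sub_add_right_eq_sub y x0 halfShift⟩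
      · intro e; exact hne (add_right_cancel e)
      · rw [dist_add_right]; simpa using hle
  obtain ⟨s, hs, Φ, hbij, hiff⟩ := h S ⟨_, hB1S (barlowPos_mem 0 0 0)⟩ hgood
  -- a point of the first copy and its preimage
  set y0 : E3 := barlowPos 1 (1 * Real.sqrt (2 / 3)) constHagg 0 0 0 with hy0def
  have hy0 : y0 ∈ B1 := barlowPos_mem 0 0 0
  obtain ⟨p0, hp0, hp0y⟩ := hbij.surjOn (hB1S hy0)
  have hh1 : Real.sqrt (2 / 3) ^ 2 = 2 / 3 * (1 : ℝ) ^ 2 := by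
    rw [Real.sq_sqrt (by norm_num)]; ring
  set Q1 := {q : E3 | q ∈ barlowStacking 1 (Real.sqrt (2 / 3)) s ∧ dist p0 q = 1} with hQ1def
  have hQ1 : Q1.ncard = 12 := ncard_touching_eq_twelve hs one_pos hh1 hp0
  have hQ1fin : Q1.Finite := Set.finite_of_ncard_ne_zero (by rw [hQ1]; norm_num)
  set N := {y : E3 | y ∈ S ∧ 0 < dist y0 y ∧ dist y0 y ≤ 28 / 25} with hNdef
  have hNsub : N ⊆ Φ '' Q1 := by
    rintro y ⟨hyS, hpos, hle⟩
    obtain ⟨q, hqB, rfl⟩ := hbij.surjOn hyS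
    rw [← hp0y] at hpos hle
    exact ⟨q, ⟨hqB, (hiff p0 hp0 q hqB).2 ⟨hpos, hle⟩⟩, rfl⟩
  have hNfin : N.Finite := (hQ1fin.image Φ).subset hNsub
  have hN12 : N.ncard ≤ 12 :=
    calc N.ncard ≤ (Φ '' Q1).ncard := Set.ncard_le_ncard hNsub (hQ1fin.image Φ)
      _ ≤ Q1.ncard := Set.ncard_image_le hQ1fin
      _ = 12 := hQ1
  -- the twelve touching points of `y0` in the first copy, and the shifted copy of `y0`
  set T0 := {y : E3 | y ∈ B1 ∧ dist y0 y = 1} with hT0def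
  have hT0 : T0.ncard = 12 := ncard_touching_eq_twelve isHaggSeq_const one_pos (ideal_sq 1) hy0
  have hT0fin : T0.Finite := Set.finite_of_ncard_ne_zero (by rw [hT0]; norm_num)
  have hdist0 : dist y0 (y0 + halfShift) = 1 / 2 := by
    rw [dist_comm, dist_eq_norm, add_sub_cancel_left, norm_halfShift]
  have hnot : y0 + halfShift ∉ T0 := by
    rintro ⟨-, hd⟩
    rw [hdist0] at hd
    norm_num at hd
  have hsub : insert (y0 + halfShift) T0 ⊆ N := by
    rintro y (rfl | ⟨hyB, hd⟩)
    · exact ⟨Or.inr ⟨y0, hy0, rfl⟩, by rw [hdist0]; norm_num, by rw [hdist0]; norm_num⟩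
    · exact ⟨hB1S hyB, by rw [hd]; norm_num, by rw [hd]; norm_num⟩
  have h13 : 13 ≤ N.ncard := by
    have := Set.ncard_le_ncard hsub hNfin
    rwa [Set.ncard_insert_of_notMem hnot hT0fin, hT0] at this
  omega

end Exclusivity

end Summit.AtomisticToContinuum.Crystallization.Theorems.ShellsToBarlowChartNegative
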